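import Summits.QuantumFields.YangMills.Theorems.BalabanUVNodesPortU8LocUnivDecay
import Literature.MathematicalPhysics.QuantumFieldTheory.Balaban1983to89.B6BlockDecayLapHjV1
import Literature.MathematicalPhysics.QuantumFieldTheory.Balaban1983to89.B6Eq2130TwoScaleV1Landau
import Literature.MathematicalPhysics.QuantumFieldTheory.Balaban1983to89.B5Ineq110P12Lattice

/-!
# Port piece U8 — (D1) CLAUSE 3 ROAD, STEP 1: ★★★ `abs_lapStencil_windowResp_univ_le` — THE LAPLACIAN KERNEL ROW OF THE WHOLE-TORUS WINDOW RESPONSE,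
# `|Σ_ν [W(b+e_ν) − 2W(b) + W(b−e_ν)]| ≤ C·η²·e^{−δ·|block_{k+1}(b₋) − l₂|_{T,∞}}`, `W = windowResp F k K univ l`, with `δ > 0`, `C ≥ 0` depending on the family `F` only
# (p22's PROVED [B6] (2.130)∕Prop. 2.5 row `B6BlockDecayLapHjV1.blockBound_LapHj_scaling` — «`ΔH_j` has an exponentially decaying block kernel» — at `d + 1 = 4`)

Cell `ym-nodeO-ideate` ∕ `ym-balaban-port`, porter `ymgap-nodeO-port-PTB-1` (gen 5).  JOIN-side helper for **stmt-QuantumFields-27238** (K0ᴬ), `--supports … --as helper`.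
[15] = [Balaban1985Variational], [B5] = [Balaban1984PropagatorsI], [B6] = [Balaban1984PropagatorsII].

WHY THIS CLOSES THE g4 GAP.  g4 left clause 3 of (‴-LocUniv) (the Laplacian face of [15] (190)) displayed, reading it as (137) `∂*∂H` + [15] (140) `∂P∂*H` and finding no
`∂P∂*H` row in the tree.  The Laplacian of Bałaban's minimizer is, however, ALREADY a tree theorem in one piece: p22's `blockBound_LapHj_scaling` bounds the block kernel of
`ΔH_j = Σ_ν∇_ν*∇_νH_j` (`= (∂*∂ + ∂∂*)H_j` componentwise, [B5] (1.21)) through (2.130) `H_j = G^{(n^{d+1})}Q_j*(Δ_j + n^{d+1})` and [B5] Prop. 1.2's member `|(ΔGJ)(x)|`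
(1.110) — no projection `P` needed.  THIS FILE reads that row on DEF-1's selector-free response `windowResp … Finset.univ`.

WHAT IS PROVED (kernel, sorry-free; `hk2 : k + 2 ≤ m + K` — one spare level, automatic at the port's volumes).
§1 ★ `Hj_single_eq_toLp_windowResp_univ` — p22∕r03's concrete two-scale `H_{k+1}` (`(tsV1 …).Hj`, ANY `Λ′`, ANY weights, ANY `DecidableEq` inside the unit source) on the unit source
   `e_{⟨l₂,l₁⟩}` IS `toLp (windowResp F k K univ l)`: both are carried by `tVE` to (1.63)'s `hkT … (tB 𝟙_{⟨l₂,l₁⟩})` (✓`B6Eq2130TwoScaleV1Landau.tVE_Hj`, ✓`tVE_windowResp_univ`).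
§2 ★★★ `abs_lapStencil_windowResp_univ_le` — `∃ δ > 0, ∃ C ≥ 0` (p22's constants at `d = 3`, `L = F.L`) with, for every volume `K`, level `k` (`k + 2 ≤ m + K`), label `l`, fine bond `b`:
   `|Σ_ν (W ⟨b₋+e_ν, μ_b⟩ − 2·W b + W ⟨b₋−e_ν, μ_b⟩)| ≤ C · eta (k+1)² · exp(−δ·|rep(block_{k+1} b₋) − rep l₂|_{T,∞})` — p22's row (summed over the unit bonds at a unit site, so in
   particular termwise), §1, ✓`B6BlockDecayGLapBridgeV1.Lap_apply` (`(Σ_ν∇_ν*∇_νx)(b) = n²·Σ_ν(2x(b) − x(b−e_ν) − x(b+e_ν))`, `n = L^{k+1}`) and `n²·η² = 1`.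
   Clerical point (as in g4's ✓`abs_curlCurl_windowResp_univ_le`, recorded for custody): p22's row is stated over the LITERAL record `⟨3+1, L, m, K, _, _⟩` with the classical
   `DecidableEq` inside `EuclideanSpace.single`; it is phrased here as a predicate of (record, instance), proved at the literal record, transported along `rfl : ⟨3+1, F.L, F.m, K, _, _⟩ = F.P K`;
   §1 being instance-generic, no instance normalisation is needed.

HONEST FRAMING.  Bookkeeping over PROVED tree theorems (p22∕r03's [B6] Sect. C layer and its [B5] Prop. 1.2 input, DEF-1∕PTZ-1's window currency); the scalar Laplacian face of (‴-LocUniv)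
at rate `η²` for `windowResp` (`η³` for `recordHrLocξ = η·windowResp·ρ₈` — the token-letter clause 3 is the next, purely algebraic file); (Tok-cmpU-cap) NOT touched; nothing of Bałaban's
renormalization-group analysis asserted; K0ᴬ 27238 OPEN; NODE O 0∕1; COUNT 8∕28 · K 1∕4 UNMOVED; finite `𝕋⁴_{L^K}` at fixed ε — NOT continuum ∕ OS ∕ Clay; **the Yang–Mills mass gap (Clay) is NOT proved.**
-/

noncomputable section

open scoped BigOperators InnerProductSpace Matrix

namespace Summit.QuantumFields.YangMills.Theorems.PortU8

open Literature.MathematicalPhysics.QuantumFieldTheory.Balaban1983to89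
open Literature.MathematicalPhysics.QuantumFieldTheory.Balaban1983to89.T4Continuum (T4Family)
open Literature.MathematicalPhysics.QuantumFieldTheory.BalabanImbrieJaffe1984to88.BIJ85AxialPropagator411 (BondSpace)
open Literature.MathematicalPhysics.QuantumFieldTheory.Balaban1983to89.B6SectAOperatorsV1 (onE)
open Literature.MathematicalPhysics.QuantumFieldTheory.Balaban1983to89.B6SectCTwoScaleV1 (CIdx)
open Literature.MathematicalPhysics.QuantumFieldTheory.Balaban1983to89.B6SectCTwoScaleV1Lattice (tsV1)
open Literature.MathematicalPhysics.QuantumFieldTheory.Balaban1983to89.B5Eq117TorusCarriers (Mk tB)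
open Literature.MathematicalPhysics.QuantumFieldTheory.Balaban1983to89.B5Eq118OneStroke (iterBlockOf)
open Literature.MathematicalPhysics.QuantumFieldTheory.Balaban1983to89.B5Prop12FieldsLattice (distSite)
open Literature.MathematicalPhysics.QuantumFieldTheory.Balaban1983to89.B5HkOpLandauMin (hkT)
open Literature.MathematicalPhysics.QuantumFieldTheory.Balaban1983to89.B5Eq147TorusBridge (tVE)
open Literature.MathematicalPhysics.QuantumFieldTheory.Balaban1983to89.B4TorusKernel.MultiPeriod (torusSupNorm)
open Literature.MathematicalPhysics.QuantumFieldTheory.Balaban1983to89.B6LowerBound2153Torus (rep)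
open Literature.MathematicalPhysics.QuantumFieldTheory.Balaban1983to89.B6BlockDecayGLapBridgeV1 (Lap_apply)
open Summit.QuantumFields.YangMills.Theorems.K0RecordFormatNames

variable (F : T4Family) {k K : ℕ}

/-- One term of a sum of absolute values is dominated by any bound of the sum. [cite: Balaban1984PropagatorsII, (2.150) p.249 (bookkeeping, ours)] -/
theorem abs_term_le_of_sum_le {ι : Type*} {s : Finset ι} {f : ι → ℝ} {M : ℝ} (h : ∑ i ∈ s, |f i| ≤ M) {a : ι} (ha : a ∈ s) :
    |f a| ≤ M :=
  (Finset.single_le_sum (f := fun i => |f i|) (fun i _ => abs_nonneg (f i)) ha).trans h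

/-! ## §1  p22∕r03's concrete two-scale `H_{k+1}` on a unit source IS the whole-torus window response -/

/-- ★ **`H_{k+1} e_{⟨l₂,l₁⟩} = toLp (windowResp F k K univ l)`** for p22∕r03's concrete two-scale `H_j = G_jQ_j*(Q_jG_jQ_j*)⁻¹` of (2.130) (`(tsV1 …).Hj`; it does not depend on `Λ′`
nor on the weights, and the statement holds for every `DecidableEq` carried by the unit source): both sides are carried by the tower transport `tVE` to (1.63)'s closed form `hkT`
on the indicator datum of `⟨l₂, l₁⟩`. [cite: Balaban1984PropagatorsII, (2.130) p.246, (2.35) p.228; Balaban1984PropagatorsI, (1.63) p.28] -/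
theorem Hj_single_eq_toLp_windowResp_univ (hk2 : k + 1 + 1 ≤ (F.P K).m + (F.P K).K) (hc : (((F.P K).L : ℝ) ^ (k + 1)) ≠ 0)
    (Λ' : Finset (Site (F.P K) (k + 1 + 1))) {w : CIdx (P := F.P K) (k + 1) Λ' → ℝ} (hw : ∀ i, 0 < w i)
    (dI : DecidableEq (PBond (F.P K) (k + 1))) (l : RespLabel F k K) :
    (tsV1 (P := F.P K) (c := ((F.P K).L : ℝ) ^ (k + 1)) hc Λ' w).Hj (@EuclideanSpace.single _ ℝ _ dI (⟨l.2, l.1⟩ : PBond (F.P K) (k + 1)) (1 : ℝ)) =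
      WithLp.toLp 2 (windowResp F k K Finset.univ l) := by
  apply (tVE (F.P K) (Nat.le_of_succ_le hk2)).injective
  rw [tVE_windowResp_univ F (Nat.le_of_succ_le hk2) l]
  have h1 : @EuclideanSpace.single _ ℝ _ dI (⟨l.2, l.1⟩ : PBond (F.P K) (k + 1)) (1 : ℝ) =
      WithLp.toLp 2 (@Pi.single (PBond (F.P K) (k + 1)) (fun _ => ℝ) _ dI (⟨l.2, l.1⟩ : PBond (F.P K) (k + 1)) (1 : ℝ)) := rfl
  rw [h1, B6Eq2130TwoScaleV1Landau.tVE_Hj hc hk2 Λ' hw]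
  congr 2
  funext c
  by_cases h : c = ⟨l.2, l.1⟩
  · subst h
    simp
  · rw [if_neg h]
    exact Pi.single_eq_of_ne h _

/-! ## §2  ★★★ The Laplacian kernel row of the whole-torus window response -/

open Classical in
/-- ★★★ **THE LAPLACIAN KERNEL ROW OF THE WHOLE-TORUS WINDOW RESPONSE**: there are `δ > 0`, `C ≥ 0` depending on the family `F` only (through `L`; p22's [B6] Prop. 2.5
constants at `d + 1 = 4`) such that for every volume `K`, level `k` with one spare level (`k + 2 ≤ m + K`), label `l` and fine bond `b`,
`|Σ_ν (W ⟨b₋+e_ν, μ_b⟩ − 2·W b + W ⟨b₋−e_ν, μ_b⟩)| ≤ C · η² · e^{−δ·|rep(block_{k+1} b₋) − rep l₂|_{T,∞}}`, `W = windowResp F k K univ l`, `η = eta (k+1) = L^{−(k+1)}` — p22's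
row «`Σ_{b′ : b′₋ = y}|(Σ_ν∇_ν*∇_νH_j)(e_{b′})_{b}| ≤ C e^{−δ|y(b₋) − y|_T}`» (2.130)∕Prop. 2.5∕[B5] (1.110) at `y = l₂`, its term `b′ = ⟨l₂, l₁⟩`, §1, and `∇_ν*∇_ν = n²·(2 − S_ν⁻¹ − S_ν)`
with `n²η² = 1`. [cite: Balaban1984PropagatorsII, (2.130) p.246, Prop. 2.5 p.246; Balaban1984PropagatorsI, Prop. 1.2 (1.110) p.35, (1.21) p.21; Balaban1985Variational, (190) p.308] -/
theorem abs_lapStencil_windowResp_univ_le :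
    ∃ δ : ℝ, 0 < δ ∧ ∃ C : ℝ, 0 ≤ C ∧ ∀ (K k : ℕ) (_hk2 : k + 1 + 1 ≤ (F.P K).m + (F.P K).K) (l : RespLabel F k K) (b : PBond (F.P K) 0),
      |∑ ν : Fin (F.P K).d, (windowResp F k K Finset.univ l ⟨b.src.shift ν, b.dir⟩ - 2 * windowResp F k K Finset.univ l b +
          windowResp F k K Finset.univ l ⟨b.src.unshift ν, b.dir⟩)| ≤
        C * (F.P K).eta (k + 1) ^ 2 *
          Real.exp (-(δ * torusSupNorm (Mk (F.P K) (k + 1)) (rep (Mk (F.P K) (k + 1)) (iterBlockOf (k + 1) b.src) - rep (Mk (F.P K) (k + 1)) l.2))) := by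
  have hd4 : 1 ≤ 3 + 1 := by norm_num
  obtain ⟨δ, hδ, C, hC, hR⟩ := B6BlockDecayLapHjV1.blockBound_LapHj_scaling 3 F.L hd4 F.hL
  refine ⟨δ, hδ, C, hC, fun K k hk2 l b => ?_⟩
  have hLc : (((F.P K).L : ℝ) ^ (k + 1)) ≠ 0 := pow_ne_zero _ (Nat.cast_ne_zero.2 (F.P K).L_pos.ne')
  /- p22's row is stated over the literal record `⟨3+1, L, m, K, _, _⟩` (ours is `F.P K`, definitionally the same record) and carries the classical `DecidableEq` inside
  `EuclideanSpace.single`.  The TERMWISE row is phrased as a predicate `Sb` of (record, instance): proved at the literal record with p22's instance (read off by unification),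
  transported along `rfl : ⟨3+1, …⟩ = F.P K`; §1 is instance-generic, so the transported instance is consumed as it comes. -/
  let Sb : (P : Params) → DecidableEq (PBond P (k + 1)) → Prop := fun P dI =>
    ∀ (hc : ((P.L : ℝ) ^ (k + 1)) ≠ 0) (_hk : k + 1 + 1 ≤ P.m + P.K) (b₀ : PBond P 0) (b₁ : PBond P (k + 1)),
      |((∑ ν : Fin P.d, ((((P.L : ℝ) ^ (k + 1)) • (onE (LinearMap.funLeft ℝ ℝ (fun b' : PBond P 0 => (⟨b'.src.unshift ν, b'.dir⟩ : PBond P 0))) - LinearMap.id) : BondSpace P →ₗ[ℝ] BondSpace P)) ∘ₗ ((((P.L : ℝ) ^ (k + 1)) • (onE (LinearMap.funLeft ℝ ℝ (fun b' : PBond P 0 => (⟨b'.src.shift ν, b'.dir⟩ : PBond P 0))) - LinearMap.id) : BondSpace P →ₗ[ℝ] BondSpace P))) ∘ₗ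
          (tsV1 hc (∅ : Finset (Site P (k + 1 + 1))) (fun _ => (1 : ℝ))).Hj) (@EuclideanSpace.single _ ℝ _ dI b₁ (1 : ℝ)) b₀| ≤
        C * Real.exp (-(δ * distSite (Mk P (k + 1)) (iterBlockOf (k + 1) b₀.src) b₁.src))
  have hP : (⟨3 + 1, F.L, F.m, K, hd4, F.hL⟩ : Params) = F.P K := rfl
  -- p22's row at the literal record, termwise, with p22's own instance (read off by unification)
  obtain ⟨dR, hSR⟩ : ∃ dI, Sb (⟨3 + 1, F.L, F.m, K, hd4, F.hL⟩ : Params) dI := by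
    refine ⟨?_, fun hc hk b₀ b₁ => ?_⟩
    rotate_left
    · dsimp only
      have h := hR F.m K (k + 1) hc hk (∅ : Finset (Site (⟨3 + 1, F.L, F.m, K, hd4, F.hL⟩ : Params) (k + 1 + 1))) (fun _ => (1 : ℝ))
        (fun _ => one_pos) b₀ b₁.src
      rw [← B5Ineq110P12Lattice.distSite_eq_torusSupNorm] at h
      have h1 := abs_term_le_of_sum_le h (Finset.mem_filter.2 ⟨Finset.mem_univ b₁, rfl⟩)
      -- p22's instance inside the unit source is read off `h1` by unification
      convert h1 using 2
  -- transport the instance-closed row along `rfl : ⟨3+1, F.L, F.m, K, _, _⟩ = F.P K`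
  have hS : ∃ dI, Sb (F.P K) dI := hP ▸ (⟨dR, hSR⟩ : ∃ dI, Sb (⟨3 + 1, F.L, F.m, K, hd4, F.hL⟩ : Params) dI)
  obtain ⟨dK, hSK⟩ := hS
  have hrow := hSK hLc hk2 b ⟨l.2, l.1⟩
  -- back to the torus sup-distance of representatives (the dimension implicit read at `F.P K`)
  have hts : distSite (d := (F.P K).d) (Mk (F.P K) (k + 1)) (iterBlockOf (k + 1) b.src) l.2 =
      torusSupNorm (Mk (F.P K) (k + 1)) (rep (Mk (F.P K) (k + 1)) (iterBlockOf (k + 1) b.src) - rep (Mk (F.P K) (k + 1)) l.2) :=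
    B5Ineq110P12Lattice.distSite_eq_torusSupNorm (Mk (F.P K) (k + 1)) _ _
  rw [show (⟨l.2, l.1⟩ : PBond (F.P K) (k + 1)).src = l.2 from rfl, hts, LinearMap.comp_apply,
    Hj_single_eq_toLp_windowResp_univ F hk2 hLc ∅ (fun _ => one_pos) dK l, Lap_apply] at hrow
  -- `Σ_ν n²(2W(b) − W(b−e_ν) − W(b+e_ν)) = −n² · Σ_ν (W(b+e_ν) − 2W(b) + W(b−e_ν))`, and `η²·n² = 1`
  have hsum : (∑ ν : Fin (F.P K).d, (((F.P K).L : ℝ) ^ (k + 1)) ^ 2 *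
      (2 * (WithLp.toLp 2 (windowResp F k K Finset.univ l) : BondSpace (F.P K)) b -
        (WithLp.toLp 2 (windowResp F k K Finset.univ l) : BondSpace (F.P K)) ⟨b.src.unshift ν, b.dir⟩ -
        (WithLp.toLp 2 (windowResp F k K Finset.univ l) : BondSpace (F.P K)) ⟨b.src.shift ν, b.dir⟩)) =
      -((((F.P K).L : ℝ) ^ (k + 1)) ^ 2) * ∑ ν : Fin (F.P K).d, (windowResp F k K Finset.univ l ⟨b.src.shift ν, b.dir⟩ -
        2 * windowResp F k K Finset.univ l b + windowResp F k K Finset.univ l ⟨b.src.unshift ν, b.dir⟩) := by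
    rw [Finset.mul_sum]
    refine Finset.sum_congr rfl fun ν _ => ?_
    ring
  have hc2 : (0 : ℝ) < (((F.P K).L : ℝ) ^ (k + 1)) ^ 2 := by positivity
  have hηc : (F.P K).eta (k + 1) ^ 2 * (((F.P K).L : ℝ) ^ (k + 1)) ^ 2 = 1 := by
    unfold Params.eta
    rw [← mul_pow, inv_pow, inv_mul_cancel₀ hLc, one_pow]
  rw [hsum, abs_mul, abs_neg, abs_of_pos hc2] at hrow
  calc |∑ ν : Fin (F.P K).d, (windowResp F k K Finset.univ l ⟨b.src.shift ν, b.dir⟩ - 2 * windowResp F k K Finset.univ l b +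
          windowResp F k K Finset.univ l ⟨b.src.unshift ν, b.dir⟩)|
      = (F.P K).eta (k + 1) ^ 2 * ((((F.P K).L : ℝ) ^ (k + 1)) ^ 2 *
          |∑ ν : Fin (F.P K).d, (windowResp F k K Finset.univ l ⟨b.src.shift ν, b.dir⟩ - 2 * windowResp F k K Finset.univ l b +
            windowResp F k K Finset.univ l ⟨b.src.unshift ν, b.dir⟩)|) := by
        rw [← mul_assoc, hηc, one_mul]
    _ ≤ (F.P K).eta (k + 1) ^ 2 * (C * Real.exp (-(δ * torusSupNorm (Mk (F.P K) (k + 1))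
          (rep (Mk (F.P K) (k + 1)) (iterBlockOf (k + 1) b.src) - rep (Mk (F.P K) (k + 1)) l.2)))) :=
        mul_le_mul_of_nonneg_left hrow (sq_nonneg _)
    _ = C * (F.P K).eta (k + 1) ^ 2 * Real.exp (-(δ * torusSupNorm (Mk (F.P K) (k + 1))
          (rep (Mk (F.P K) (k + 1)) (iterBlockOf (k + 1) b.src) - rep (Mk (F.P K) (k + 1)) l.2))) := by ring

end Summit.QuantumFields.YangMills.Theorems.PortU8

end
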